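import Summits.AtomisticToContinuum.Crystallization.Theorems.FrustratedLawDichotomyStrainedPatchHomConvexSegment
import Summits.AtomisticToContinuum.Crystallization.Theorems.FrustratedLawDichotomyStrainedPatchTaylorRegular
import Summits.AtomisticToContinuum.Crystallization.Theorems.FrustratedLawDichotomyStrainedPatchHomLatticeBoxHcp

/-!
# ξ-elimination for the hcp shifted-family sum of the RECORD potential `W₄₅` (regularity discharged; sequel of `…HomConvexSegment`)

decomp-a2c hand-1 g26 (crux `AperiodicFrustratedLawGap`, stmt-AtomisticToContinuum-27623; `(H) HomFloor (1/625)`, hcp half; critic row 1026 (C)).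
`…HomConvexSegment.hcpShifted_floor_of_curvature` is generic in the pair potential.  Here `W = Wrec = effPot w₄₅ ω₄ (3/400)`: its regularity inputs are
DISCHARGED from the tree (lens-5 g53 `…TaylorRegular.wrecC1_holds`: `W₄₅′` continuous on `(0, ∞)` and differentiable off the junction radii
`{8/5, 3, 9/2}`; `…TaylorLeaves.differentiableAt_Wrec`), the tube floor `3/8` comes from `‖U − 1‖ ≤ 1/4`, `‖ξ₀‖, ‖ξ‖ ≤ 1/4`
(`…HomLatticeBoxHcp.norm_shifted_gt`, convexity of the shuffle ball), the tube ceiling is internal, and the degenerate direction `U(ξ − ξ₀) = 0` is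
trivial.  What remains for the kernel `λ`-leaf are exactly three NUMERIC certificates over its `U`-box: the value `V`, the slope `G` and the
curvature-sum floor `λ` off the junction parameters.

★★★ `hcpShifted_floor_W45`.  NO definitions; 0 sorry; standard axioms; no instances / notation / `#eval`.  `--supports stmt-AtomisticToContinuum-27623`.
-/

noncomputable section

namespace Summit.AtomisticToContinuum.Crystallization.Theorems.FrustratedLawDichotomyStrainedPatchHomConvexSegment

open scoped BigOperators
open Summit.AtomisticToContinuum.Crystallization.Theorems.FrustratedLawDichotomyStrainedPatchTaylorChord (segR segG segGd)
open Summit.AtomisticToContinuum.Crystallization.Theorems.ChargedEnergyGapNegative (E3)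
open Summit.AtomisticToContinuum.Crystallization.Theorems.FrustratedLawDichotomyStrainedPatchHomSplit (latPt hexFrame hcpShift)
open Summit.AtomisticToContinuum.Crystallization.Theorems.FrustratedLawDichotomyStrainedPatchEnvelopeTaylor (Wrec)
open Summit.AtomisticToContinuum.Crystallization.Theorems.FrustratedLawDichotomyStrainedPatchTaylorLeaves (junctions differentiableAt_Wrec)
open Summit.AtomisticToContinuum.Crystallization.Theorems.FrustratedLawDichotomyStrainedPatchTaylorRegular
  (continuousOn_deriv_Wrec differentiableAt_deriv_Wrec)
open Summit.AtomisticToContinuum.Crystallization.Theorems.FrustratedLawDichotomyStrainedPatchHomLatticeBoxHcp (norm_shifted_gt)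

/-- The shuffle ball is convex: `‖ξ₀‖, ‖ξ‖ ≤ 1/4`, `s ∈ [0,1]` ⟹ `‖ξ₀ + s(ξ − ξ₀)‖ ≤ 1/4`. [folklore] -/
theorem norm_shuffle_segment_le {ξ₀ ξ : E3} (h0 : ‖ξ₀‖ ≤ 1 / 4) (h1 : ‖ξ‖ ≤ 1 / 4) {s : ℝ} (hs : s ∈ Set.Icc (0 : ℝ) 1) :
    ‖ξ₀ + s • (ξ - ξ₀)‖ ≤ 1 / 4 := by
  have hdec : ξ₀ + s • (ξ - ξ₀) = (1 - s) • ξ₀ + s • ξ := by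
    rw [smul_sub, sub_smul, one_smul]; abel
  rw [hdec]
  calc ‖(1 - s) • ξ₀ + s • ξ‖ ≤ ‖(1 - s) • ξ₀‖ + ‖s • ξ‖ := norm_add_le _ _
    _ = (1 - s) * ‖ξ₀‖ + s * ‖ξ‖ := by
        rw [norm_smul, norm_smul, Real.norm_eq_abs, Real.norm_eq_abs, abs_of_nonneg (by linarith [hs.2]), abs_of_nonneg hs.1]
    _ ≤ (1 - s) * (1 / 4) + s * (1 / 4) := by gcongr <;> linarith [hs.1, hs.2]
    _ = 1 / 4 := by ring

/-- ★★★ **ξ-ELIMINATION FOR THE hcp SHIFTED-FAMILY SUM OF `W₄₅`** (regularity discharged).  For `‖U − 1‖ ≤ 1/4`, `‖ξ₀‖, ‖ξ‖ ≤ 1/4`, any label finset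
`B`, `0 < λ`, and three certificates at the reference shuffle `ξ₀` along `Δ = U(ξ − ξ₀)` — VALUE `V ≤ Σ_b W₄₅‖p_b‖`, SLOPE `|Σ_b segG W₄₅′ p_b Δ 0| ≤ G‖Δ‖`,
CURVATURE-SUM `λ‖Δ‖² ≤ Σ_b segGd W₄₅′ p_b Δ s` at every `s ∈ (0,1)` whose radii avoid the junctions `{8/5, 3, 9/2}` (`p_b = latPt U hexFrame b +
U(hcpShift + ξ₀)`) — the floor `V − G²/(2λ) ≤ Σ_b W₄₅‖latPt U hexFrame b + U(hcpShift + ξ)‖` holds. [folklore chaining] -/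
theorem hcpShifted_floor_W45 (B : Finset (Fin 3 → ℤ)) {U : E3 →L[ℝ] E3} (hU : ‖U - 1‖ ≤ 1 / 4) {ξ₀ ξ : E3} (hξ₀ : ‖ξ₀‖ ≤ 1 / 4) (hξ : ‖ξ‖ ≤ 1 / 4)
    {lam G V : ℝ} (hlam : 0 < lam)
    (hcurv : ∀ s ∈ Set.Ioo (0 : ℝ) 1,
      (∀ bb ∈ B, segR (latPt U hexFrame bb + U (hcpShift + ξ₀)) (U (ξ - ξ₀)) s ∉ junctions) →
      lam * ‖U (ξ - ξ₀)‖ ^ 2 ≤ ∑ bb ∈ B, segGd (deriv Wrec) (latPt U hexFrame bb + U (hcpShift + ξ₀)) (U (ξ - ξ₀)) s)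
    (hV : V ≤ ∑ bb ∈ B, Wrec ‖latPt U hexFrame bb + U (hcpShift + ξ₀)‖)
    (hG : |∑ bb ∈ B, segG (deriv Wrec) (latPt U hexFrame bb + U (hcpShift + ξ₀)) (U (ξ - ξ₀)) 0| ≤ G * ‖U (ξ - ξ₀)‖) :
    V - G ^ 2 / (2 * lam) ≤ ∑ bb ∈ B, Wrec ‖latPt U hexFrame bb + U (hcpShift + ξ)‖ := by
  by_cases hΔ : U (ξ - ξ₀) = 0
  · -- degenerate direction: `ξ` and `ξ₀` give the same points
    have hUeq : U (hcpShift + ξ) = U (hcpShift + ξ₀) := by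
      have : hcpShift + ξ = (hcpShift + ξ₀) + (ξ - ξ₀) := by abel
      rw [this, map_add, hΔ, add_zero]
    have hnn : 0 ≤ G ^ 2 / (2 * lam) := by positivity
    rw [hUeq]
    linarith
  -- the tube: floor 3/8 from the lattice geometry, ceiling from finiteness
  set p : (Fin 3 → ℤ) → E3 := fun bb => latPt U hexFrame bb + U (hcpShift + ξ₀) with hp
  set Δ : E3 := U (ξ - ξ₀) with hΔdef
  set bhi : ℝ := (∑ bb ∈ B, ‖p bb‖) + ‖Δ‖ + 1 with hbhi
  have hseg : ∀ bb : Fin 3 → ℤ, ∀ s : ℝ, p bb + s • Δ = latPt U hexFrame bb + U (hcpShift + (ξ₀ + s • (ξ - ξ₀))) := by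
    intro bb s
    simp only [hp, hΔdef, map_add, map_smul]
    abel
  have htube : ∀ bb ∈ B, ∀ s ∈ Set.Icc (0 : ℝ) 1, 3 / 8 ≤ ‖p bb + s • Δ‖ ∧ ‖p bb + s • Δ‖ ≤ bhi := by
    intro bb hbb s hs
    constructor
    · rw [hseg]
      exact (norm_shifted_gt hU (norm_shuffle_segment_le hξ₀ hξ hs) bb).le
    · have h1 : ‖p bb + s • Δ‖ ≤ ‖p bb‖ + ‖Δ‖ := by
        calc ‖p bb + s • Δ‖ ≤ ‖p bb‖ + ‖s • Δ‖ := norm_add_le _ _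
          _ ≤ ‖p bb‖ + ‖Δ‖ := by
              rw [norm_smul, Real.norm_eq_abs, abs_of_nonneg hs.1]
              nlinarith [norm_nonneg Δ, hs.2]
      have h2 : ‖p bb‖ ≤ ∑ bb ∈ B, ‖p bb‖ := Finset.single_le_sum (fun _ _ => norm_nonneg _) hbb
      rw [hbhi]; linarith
  have ha : (0 : ℝ) < 3 / 8 := by norm_num
  have hW : ∀ r, (3 : ℝ) / 8 ≤ r → r ≤ bhi → HasDerivAt Wrec (deriv Wrec r) r := fun r hr _ =>
    (differentiableAt_Wrec (ha.trans_le hr).ne').hasDerivAt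
  have hcont : ContinuousOn (deriv Wrec) (Set.Icc (3 / 8) bhi) := continuousOn_deriv_Wrec.mono fun r hr => ha.trans_le hr.1
  have hdiff : ∀ r, (3 : ℝ) / 8 < r → r < bhi → r ∉ junctions → HasDerivAt (deriv Wrec) (deriv (deriv Wrec) r) r :=
    fun r hr _ hJ => (differentiableAt_deriv_Wrec (ha.trans hr) hJ).hasDerivAt
  have hcurv' : ∀ s ∈ Set.Ioo (0 : ℝ) 1, (∀ bb ∈ B, 3 / 8 < segR (p bb) Δ s ∧ segR (p bb) Δ s < bhi ∧ segR (p bb) Δ s ∉ junctions) →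
      lam * ‖Δ‖ ^ 2 ≤ ∑ bb ∈ B, segGd (deriv Wrec) (p bb) Δ s :=
    fun s hs hgood => hcurv s hs fun bb hbb => (hgood bb hbb).2.2
  exact hcpShifted_floor_of_curvature B U ξ₀ ξ hΔ junctions ha hlam hW hcont hdiff htube hcurv' hV hG

end Summit.AtomisticToContinuum.Crystallization.Theorems.FrustratedLawDichotomyStrainedPatchHomConvexSegment

end
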